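import Summits.ABC.IUTFork.Cor312PinnedRegionsThreePins
import Summits.ABC.IUTFork.Cor312ColumnTransport
import Summits.ABC.IUTFork.Cor312QTwist
import HarnessLib

/-!
# The pinned gap row's residual is glue-blind and column-free (row C-15)

GAP row G-w5d230-1 (the «G-PR1-1» row of the pinned round) isolates the disputed inference of
[IUTchIII] Cor. 3.12, Steps (xi-e)/(xi-f) p. 183 l. 43 – p. 184 l. 29, as the RESIDUAL
`Cor312Vol.PilotKummerIndRelated S P ρ qK` (p418935): the q-pilot's Kummer datum generates the same
ρ-region as the splitting monoid of SOME `(Ind1)(Ind2)`-translate of the column-`n` coric data.  This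
file adds the residual to the TEAM C canonicity census (C-8/C-9/C-10 for G-c312-9-1, C-14a/b for
G-c312-11-1): the isolated statement depends on NO unforced choice of the frozen types.

Two facts, both cheap BY DESIGN of the residual and recorded so adversaries see them in the kernel:

* **GLUE-BLINDNESS** (§1): `PilotKummerIndRelated` reads only the column index `P.n` and the ambient
  `(ρ, qK)` data — so under the Θ-glue `(Ind1)(Ind2)` twist (row C-1), the `(Ind3)` m-reindex (rows
  C-1/C-9), and the q-glue twist (row C-7) it is invariant by `Iff.rfl`: re-choosing EITHER Kummer glue
  within (or beyond) its declared indeterminacy, or relabelling the lattice positions, does not move the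
  residual AT ALL.  (Contrast: the Corollary's `Statement` and the route inputs need the Step (x) volume
  engine for the same invariances — C-1/C-7/C-14.)
* **COLUMN-FREEDOM** (§2): under the étale-picture transport (row C-3) the residual transports with NO
  reading clause — `S.RLGP n′ = S.RLGP P.n` for every transport `Φ` in the indeterminacy group, by the
  landed orbit law `MRData.RLGP_map_eq_of_mem_indGroup` (c312-1, Thm311PilotProofs) — so
  `recolumn_pilotKummerIndRelated_iff` holds outright.  CONTRAST, kernel-checked on the other side: the
  PINS themselves carry the WHOLE étale-coricity cost — C-13's `thetaPinned_recolumn_of_frobCompat`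
  needs the explicit cross-column identification `hfrob`, and C-13c's `depth_not_frobCompat` shows no
  frozen clause supplies it.  So in the pinned decomposition «pins → residual» of the disputed step, the
  étale-picture symmetry constrains the PINS and never the RESIDUAL — the C-2-charter isolation of which
  identification each layer uses, at the G-w5d230-1 level.

Subjects read-only by name from p418935 (`Cor312PinnedRegionsThreePins`); transports from rows C-1/C-3/
C-7; orbit law from c312-1.  Nothing here asserts Cor. 3.12, any pin, or the residual itself;
`[claim: Mochizuki2012, status: disputed]` on statements quoting the print, bookkeeping `[folklore]`.
-/

noncomputable section

namespace Summit.ABC.IUTFork.Cor312Vol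

open Thm311 Cor312 Literature.IUT.LogThetaLattice

variable {T : ThetaIndex} (S : LatticeSituation T) (P : Cor312.Setting S.toSituation)
  (ρ : (∀ v : T.V, v ∈ T.Vbad → Set (S.L.StarPacket v)) →
    ∀ (j : T.Label) (vQ : T.VQ), Set (S.L.Packet j vQ))
  (qK : ∀ v : T.V, v ∈ T.Vbad → Set (S.L.StarPacket v))

/-! ## 1. Glue-blindness: all three glue transports are absorbed definitionally -/

/-- **Θ-GLUE BLINDNESS**: the residual never reads the Θ-side Kummer glue — twisting it by ANY packet
automorphism family (inside or outside the indeterminacy group) changes nothing, definitionally.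
[folklore] -/
theorem twistGlue_pilotKummerIndRelated (Φ₀ : S.toSituation.L.PacketAut) :
    PilotKummerIndRelated S (P.twistGlue Φ₀) ρ qK ↔ PilotKummerIndRelated S P ρ qK :=
  Iff.rfl

/-- **(Ind3) BLINDNESS**: the residual never reads the lattice labels of the Θ-glue — the m-reindex is
absorbed definitionally (contrast the m-COUPLING of the lattice-level route input,
`reindexGlue_qFrobComparison_decoupled`, row C-14b). [folklore] -/
theorem reindexGlue_pilotKummerIndRelated (e : ℤ ≃ ℤ) :
    PilotKummerIndRelated S (P.reindexGlue e) ρ qK ↔ PilotKummerIndRelated S P ρ qK :=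
  Iff.rfl

/-- **Q-GLUE BLINDNESS**: the residual never reads the q-side region glue either — its q-side input is
the KUMMER DATUM `qK`, which lives above the region layer (the (pq′) pin relates them; the pin, not the
residual, pays any transport cost — C-13 §4). [folklore] -/
theorem qTwistGlue_pilotKummerIndRelated (Φ₀ : S.toSituation.L.PacketAut)
    (hmem : ∀ (j : T.Label) (vQ : T.VQ),
      Φ₀ j vQ '' P.qRegionOf (qPilotObject P.qData) j vQ ∈ (P.frame j vQ).Hul)
    (hfin : ∀ j : T.Label, (Function.support fun vQ =>
      (S.D P.n).logvol j vQ (Φ₀ j vQ '' P.qRegionOf (qPilotObject P.qData) j vQ)).Finite) :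
    PilotKummerIndRelated S (P.qTwistGlue Φ₀ hmem hfin) ρ qK ↔ PilotKummerIndRelated S P ρ qK :=
  Iff.rfl

/-! ## 2. Column-freedom: the étale transport costs nothing at the residual -/

section Recolumn

variable (n' : ℤ) (Φ : S.toSituation.L.PacketAut) (hD : S.D n' = (S.D P.n).map Φ)

include hD in
/-- The coric-data orbit is COLUMN-INVARIANT along any indeterminacy-group transport: the `R^LGP`-class
of the transported column is the class of the original — the landed orbit law
`MRData.RLGP_map_eq_of_mem_indGroup` read through the transport equation `hD`. [folklore] -/
theorem recolumn_RLGP_eq (hΦ : Φ ∈ Setting.indGroup S.toSituation) :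
    S.RLGP (P.recolumn n' Φ hD).n = S.RLGP P.n := by
  show S.RLGP n' = S.RLGP P.n
  show (S.D n').RLGP = (S.D P.n).RLGP
  rw [hD]
  exact (S.D P.n).RLGP_map_eq_of_mem_indGroup hΦ

/-- **COLUMN-FREEDOM OF THE RESIDUAL**: `PilotKummerIndRelated` transports along the étale-picture
column transport with NO reading clause — unlike the pins, whose étale coricity costs the explicit
cross-column Kummer identification `hfrob` (C-13, C-13c).  In the pinned decomposition of Steps
(xi-e)/(xi-f), the étale symmetry constrains the PINS and never the RESIDUAL. [claim: Mochizuki2012,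
status: disputed] -/
theorem recolumn_pilotKummerIndRelated_iff (hΦ : Φ ∈ Setting.indGroup S.toSituation) :
    PilotKummerIndRelated S (P.recolumn n' Φ hD) ρ qK ↔ PilotKummerIndRelated S P ρ qK := by
  unfold PilotKummerIndRelated
  rw [recolumn_RLGP_eq S P n' Φ hD hΦ]

end Recolumn

/-! ## 3. The composed statement for the census sentence -/

/-- **CANONICITY OF THE G-w5d230-1 RESIDUAL, composed**: one simultaneous re-choice of Θ-glue,
m-labelling and column (any `Φ₀`, any `e`, any indeterminacy transport `Φ`) leaves the residual
unchanged.  With C-8/C-9/C-10 (G-c312-9-1) and C-14a/b (G-c312-11-1) this closes the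
«choice-dependent statement» objection for all three gap rows of record. [folklore] -/
theorem reindex_twist_recolumn_pilotKummerIndRelated
    (Φ₀ : S.toSituation.L.PacketAut) (e : ℤ ≃ ℤ) (n' : ℤ)
    (Φ : S.toSituation.L.PacketAut) (hD : S.D n' = (S.D P.n).map Φ)
    (hΦ : Φ ∈ Setting.indGroup S.toSituation) :
    PilotKummerIndRelated S (((P.recolumn n' Φ hD).twistGlue Φ₀).reindexGlue e) ρ qK ↔
      PilotKummerIndRelated S P ρ qK :=
  (reindexGlue_pilotKummerIndRelated S ((P.recolumn n' Φ hD).twistGlue Φ₀) ρ qK e).trans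
    ((twistGlue_pilotKummerIndRelated S (P.recolumn n' Φ hD) ρ qK Φ₀).trans
      (recolumn_pilotKummerIndRelated_iff S P ρ qK n' Φ hD hΦ))

end Summit.ABC.IUTFork.Cor312Vol
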